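/-
Copyright (c) 2026 the pub-hodgecm-mathlib formalisation cell (harness21).  Prover seat hodgecm-mathlib-F0P3-p02 (g27), 2026-09-03.  E1 row 63-D «TRANSPORT OF THE SPLITTING
HYPOTHESIS ALONG EQUIVALENCES» (offer 05:08:23Z to the row-59 datum pen F0P3-p01 (g24), docking of ★ 40″'s conclusion into ★ `EPNormOneUnr`'s `hsplit`).
-/
import Literature.NumberTheory.Automorphic.SmoothRepresentation   -- ★ `Representation.IsSmooth`
import Mathlib.RepresentationTheory.Intertwining
import HarnessLib

/-!
# Transport of «every (smooth) extension of `V` by `W` splits» along equivalences `W ≃ W′`, `V ≃ V′`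

Topic `RepresentationTheory`; namespace `Literature.RepresentationTheory` (next to ★ (J) `IntertwiningMapPresentationExtension`, ★ (J′) `…Smooth`).  THEOREMS ONLY (no definition,
no instance, no notation, no named fact, no `sorry`).  Cell `pub/hodgecm-mathlib` (D-0151), crux H413 = `stmt-HodgeConjecture-24833`, lane `--supports`; E1 row 63-D: the consumer
★ `F0P3cStCharTSEPNormOneUnr.innerG_char_self_eq_one_of_isPseudoCoeff_epThree` asks `hsplit` («every SMOOTH self-extension splits») of `r.ρ` for an ARBITRARY representative `r`
of the class `π²(ξ)`, while ★ 40″ `selfExtension_splits_of_jacquet_selfExtension` proves it for THE realisation `A ≤ i_B(χ_ξ)` (★ 63-C `⟦I₀|_A⟧ = πs` + ★ `IrrClass.mk_eq_mk_iff` give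
`e : r.ρ ≃ I₀|_A`); this file is the representation-free transport in between.  HONEST LABEL: count-neutral generic helper; E1 = PRINT until the keeper's charter test; HC_CM is
proved only modulo the printed citations (hLiu418 = `stmt-HodgeConjecture-24832`, h413 = `stmt-HodgeConjecture-24833`) until rung 0 closes.

THE MATHEMATICS [Weibel1994 §3.4; BushnellHenniart2006 §1.1].  Given equivalences `eW : W ≃ W′`, `eV : V ≃ V′` and an extension `0 → W′ —i′→ E —p′→ V′ → 0`, the maps
`i := i′ ∘ eW`, `p := eV⁻¹ ∘ p′` form an extension `0 → W → E → V → 0` of the SAME middle term (so smoothness of `E` is untouched); a section `s` of `p` gives the section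
`s ∘ eV⁻¹` of `p′`.  Hence «every extension (with smooth middle) of `V` by `W` splits» transports to `(W′, V′)`.

* `injective_comp_equiv`, `ker_equiv_symm_comp_eq`, `surjective_equiv_symm_comp` (the three hypotheses transport), **`forall_smooth_extension_split_of_equiv`** (two equivalences),
  **`forall_smooth_selfExtension_split_of_equiv`** (self-extensions, one equivalence — the shape of ★ `EPNormOneUnr`'s `hsplit`).

## References
* [Weibel1994] C. A. Weibel, *An Introduction to Homological Algebra* (1994), §3.4 (extensions; `Ext¹` is functorial in both variables, so isomorphisms transport splitting).
* [BushnellHenniart2006] C. J. Bushnell, G. Henniart, *The local Langlands conjecture for GL(2)* (2006), §1.1 (equivalent representations).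
-/

set_option autoImplicit false

namespace Literature.RepresentationTheory

open Representation Function

universe u u' v

variable {k : Type u} [CommRing k] {G : Type u'} [Group G] [TopologicalSpace G]
  {X X' Y Y' : Type v} [AddCommGroup X] [Module k X] [AddCommGroup X'] [Module k X'] [AddCommGroup Y] [Module k Y] [AddCommGroup Y'] [Module k Y']
  {ρV : Representation k G X} {ρV' : Representation k G X'} {ρW : Representation k G Y} {ρW' : Representation k G Y'}

omit [TopologicalSpace G] in
/-- `i′ ∘ eW` is injective when `i′` is. [cite: Weibel1994, §3.4] -/
theorem injective_comp_equiv (eW : ρW.Equiv ρW') {E : Type v} [AddCommGroup E] [Module k E] {ρE : Representation k G E} (i' : IntertwiningMap ρW' ρE)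
    (hi : Injective i') : Injective (i'.comp eW.toIntertwiningMap) :=
  fun a b h => eW.toLinearEquiv.injective (hi (by simpa [IntertwiningMap.comp_apply] using h))

omit [TopologicalSpace G] in
/-- `ker (eV⁻¹ ∘ p′) = range (i′ ∘ eW)` when `ker p′ = range i′`. [cite: Weibel1994, §3.4] -/
theorem ker_equiv_symm_comp_eq (eW : ρW.Equiv ρW') (eV : ρV.Equiv ρV') {E : Type v} [AddCommGroup E] [Module k E] {ρE : Representation k G E}
    (i' : IntertwiningMap ρW' ρE) (p' : IntertwiningMap ρE ρV') (hexact : LinearMap.ker p'.toLinearMap = LinearMap.range i'.toLinearMap) :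
    LinearMap.ker (eV.symm.toIntertwiningMap.comp p').toLinearMap = LinearMap.range (i'.comp eW.toIntertwiningMap).toLinearMap := by
  ext x
  constructor
  · intro hx
    have hx' : p' x = 0 := by
      have h0 : eV.symm (p' x) = 0 := by simpa [IntertwiningMap.comp_apply] using hx
      simpa using congrArg eV h0
    have hmem : x ∈ LinearMap.ker p'.toLinearMap := hx'
    rw [hexact] at hmem
    obtain ⟨w', hw'⟩ := hmem
    refine ⟨eW.symm w', ?_⟩
    rw [IntertwiningMap.toLinearMap_apply, IntertwiningMap.comp_apply]
    change i' (eW (eW.symm w')) = x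
    rw [eW.apply_symm_apply]
    exact hw'
  · rintro ⟨w, rfl⟩
    have hmem : (i'.comp eW.toIntertwiningMap) w ∈ LinearMap.ker p'.toLinearMap := by
      rw [hexact]
      exact ⟨eW w, rfl⟩
    have h0 : p' ((i'.comp eW.toIntertwiningMap) w) = 0 := hmem
    change eV.symm (p' ((i'.comp eW.toIntertwiningMap) w)) = 0
    rw [h0, map_zero]

omit [TopologicalSpace G] in
/-- `eV⁻¹ ∘ p′` is surjective when `p′` is. [cite: Weibel1994, §3.4] -/
theorem surjective_equiv_symm_comp (eV : ρV.Equiv ρV') {E : Type v} [AddCommGroup E] [Module k E] {ρE : Representation k G E} (p' : IntertwiningMap ρE ρV')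
    (hp : Surjective p') : Surjective (eV.symm.toIntertwiningMap.comp p') := fun x => by
  obtain ⟨e, he⟩ := hp (eV x)
  exact ⟨e, by rw [IntertwiningMap.comp_apply, he]; exact eV.symm_apply_apply x⟩

/-- **«EVERY SMOOTH EXTENSION OF `V` BY `W` SPLITS» TRANSPORTS ALONG EQUIVALENCES `W ≃ W′`, `V ≃ V′`** (the middle term is unchanged, so the smoothness clause is untouched): an extension
`0 → W′ —i′→ E —p′→ V′ → 0` pulls back to `0 → W —i′∘eW→ E —eV⁻¹∘p′→ V → 0`; a section `s` of `eV⁻¹ ∘ p′` yields the section `s ∘ eV⁻¹` of `p′`. [cite: Weibel1994, §3.4]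
[cite: BushnellHenniart2006, §1.1] -/
theorem forall_smooth_extension_split_of_equiv (eW : ρW.Equiv ρW') (eV : ρV.Equiv ρV')
    (hsplit : ∀ (E : Type v) [AddCommGroup E] [Module k E] (ρE : Representation k G E), ρE.IsSmooth → ∀ (i : IntertwiningMap ρW ρE) (p : IntertwiningMap ρE ρV),
      Injective i → LinearMap.ker p.toLinearMap = LinearMap.range i.toLinearMap → Surjective p → ∃ s : IntertwiningMap ρV ρE, p.comp s = IntertwiningMap.id ρV)
    (E : Type v) [AddCommGroup E] [Module k E] (ρE : Representation k G E) (hE : ρE.IsSmooth) (i' : IntertwiningMap ρW' ρE) (p' : IntertwiningMap ρE ρV')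
    (hi : Injective i') (hexact : LinearMap.ker p'.toLinearMap = LinearMap.range i'.toLinearMap) (hp : Surjective p') :
    ∃ s' : IntertwiningMap ρV' ρE, p'.comp s' = IntertwiningMap.id ρV' := by
  obtain ⟨s, hs⟩ := hsplit E ρE hE (i'.comp eW.toIntertwiningMap) (eV.symm.toIntertwiningMap.comp p') (injective_comp_equiv eW i' hi)
    (ker_equiv_symm_comp_eq eW eV i' p' hexact) (surjective_equiv_symm_comp eV p' hp)
  refine ⟨s.comp eV.symm.toIntertwiningMap, IntertwiningMap.ext (LinearMap.ext fun x' => ?_)⟩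
  have hsx : eV.symm (p' (s (eV.symm x'))) = eV.symm x' := by
    have h := congrArg (fun f : IntertwiningMap ρV ρV => f (eV.symm x')) hs
    simpa [IntertwiningMap.comp_apply] using h
  have h2 := congrArg eV hsx
  rw [eV.apply_symm_apply, eV.apply_symm_apply] at h2
  simpa [IntertwiningMap.comp_apply] using h2

/-- **SELF-EXTENSIONS**: if every smooth self-extension of `ρ` splits and `ρ ≃ ρ′`, then every smooth self-extension of `ρ′` splits — the shape of the `hsplit` binder of ★
`F0P3cStCharTSEPNormOneUnr.innerG_char_self_eq_one_of_isPseudoCoeff_epThree` (transport from THE realisation `A ≤ i_B(χ_ξ)` of ★ 40″∕★ 63-C to any representative of the class).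
[cite: Weibel1994, §3.4] [cite: BushnellHenniart2006, §1.1] -/
theorem forall_smooth_selfExtension_split_of_equiv (e : ρV.Equiv ρV')
    (hsplit : ∀ (E : Type v) [AddCommGroup E] [Module k E] (ρE : Representation k G E), ρE.IsSmooth → ∀ (i : IntertwiningMap ρV ρE) (p : IntertwiningMap ρE ρV),
      Injective i → LinearMap.ker p.toLinearMap = LinearMap.range i.toLinearMap → Surjective p → ∃ s : IntertwiningMap ρV ρE, p.comp s = IntertwiningMap.id ρV)
    (E : Type v) [AddCommGroup E] [Module k E] (ρE : Representation k G E) (hE : ρE.IsSmooth) (i' : IntertwiningMap ρV' ρE) (p' : IntertwiningMap ρE ρV')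
    (hi : Injective i') (hexact : LinearMap.ker p'.toLinearMap = LinearMap.range i'.toLinearMap) (hp : Surjective p') :
    ∃ s' : IntertwiningMap ρV' ρE, p'.comp s' = IntertwiningMap.id ρV' :=
  forall_smooth_extension_split_of_equiv e e hsplit E ρE hE i' p' hi hexact hp

end Literature.RepresentationTheory
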